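import Summits.QuantumFields.BalabanUV.Beta.D1BFx.GaugeSandwich
import Summits.QuantumFields.BalabanUV.Beta.D1BFx.VectorLegTannery
import Summits.QuantumFields.BalabanUV.Beta.D1BFx.GluonLeg
import Summits.QuantumFields.BalabanUV.Beta.D1BFx.HodgeIdentityForms
import Literature.MathematicalPhysics.QuantumFieldTheory.Balaban1983to89.Beta.KKTFluctuationUnique

/-!
# `BalabanUV.Beta.D1BFx.VectorLegEquation` — road «BF-x» for binder row D1, slot (K), **debt X₁a PROVED** (brick Q4 part 2 of `X1-SPEC.md`):
# THE REDUCED BF GLUON LEG `Ga = K^∞` SOLVES THE R-WEIGHTED VECTOR EQUATION ON ℤ⁴ —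
# `½·curvAdj (curv A) + dz (Rf n a (codiff₁ A)) + (a/n⁸)·𝒬ᵀ𝒬 A = δ_{(l,y)}` for every column `A κ x := Ga n a x y κ l`

HONEST FRAMING (cell contract, verbatim): «discharging `BetaPertH` makes Bałaban's UV stability UNCONDITIONAL — a real constructive-QFT
result; it is NOT the continuum limit and NOT the Clay problem.»  HONEST DEPENDENCY (verbatim): «continuum YM on T⁴ ⇐ BetaPertH ∧ nine
spine estimates (0/9 proved); BetaPertH ⇐ (D1) ∧ (D4) ∧ CAP+tail; G-an2-4 gates asym, D1 and NE2/3/4.»  THIS MODULE DISCHARGES NOTHING of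
D1 / BetaPertH.  It is [folklore] analysis of the cell's OWN typed objects, composed BY NAME: an5's torus propagator identity
`B5DeltaA169.DeltaA_mul_calG`, reality `VectorPropagatorLimit.calG_im_eq_zero`, the volume-free bound `abs_calG_re_le` and THE LIMIT
`calG_re_tendsto_Kinf`; gan24-leaf-06-g28's stencil dictionary `StencilDictionaryTorus` (Q2); leaf-03-g7's gauge sandwich
`GaugeSandwich.DeltaA_mulVec_periodisedProjector` (Q3c, over this lineage's `PeriodisedProjector`) and unfold-and-regroup
`FibredPeriodisation.sum_periodise₂_mul_of_rep` (Q1); `HodgeIdentityForms` (the `½`); and this lineage's `VectorLegTannery` (Q4 part 1).  Nothing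
printed is asserted (B5's equation numbers are CONTEXT locators carried by the an5 modules); no `Prop` is minted; two data `def`s with bodies
([our object] `colG`, `liftG`); 0 sorry.  NOT summit progress; NOT BetaPertH, NOT continuum, NOT Clay.

ABSOLUTE RULE (cell, verbatim): «No internally-minted statement may enter as a cited fact. Every hypothesis is either kernel-proved in this
package or a verbatim quotation of a PUBLISHED theorem with page reference. The manuscript(s) under audit are NOT citable for their own
disputed steps — they are the thing under adjudication; programme-internal (2001/route/tribunal) claims are never citable.»

WHY (`HOME/b2b-balaban-beta-d1-p2/X1-SPEC.md` v1 §0–§1; K-R1-SPEC v2 §4 «X₁»; an5-g26's ANSWER, journal 2026-08-20 l.19088: «It is NOT asserted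
[in the tree] that K^∞ inverts an infinite-volume Δ_a on ℤ^d»).  X₁a is the ONE analytic input of slot (K)'s kernel dictionary (B6/B6′/B7:
`LandauDictionaryHWeighted`, `LandauResolventSuperposition`, `LandauDictionaryGamma*` display it as the hypothesis `hX1a`).  THE ROUTE (Tannery on
columns): per even cubic volume `t`, the column of an5's `calG_t = Δ_a⁻¹` at the source `(ȳ, l)` solves `DeltaA_t *ᵥ col = δ` on the torus; read at a
reduced point `castT x` through Q2 + Q3c, the left-hand side is `(m+1)²` times the (X₁a) operator applied to the REAL PERIODIC LIFT of the column; the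
lifts converge pointwise to `Ga/(m+1)²` with the volume-free bound `1/γ₀`, and the right-hand sides are eventually the Kronecker delta of `ℤ⁴`; `VectorLegTannery`
passes the identity to the limit.  No decay of `Ga` is used; no symbol is compared.

CONTENT (d = 4; an5 level `m + 1 ≥ 1` = the road's block side `n`, pv23 block side `m + 1`; `a > 0`).
* §1 `colG`, `liftG` (the column and its real lift), `liftT1_colG` (the complex lift is `ofR1 liftG`), `colG_eq_ofReal`, `DeltaA_mulVec_colG`
  (the torus identity, columnwise), `abs_liftG_le` (`≤ 1/γ₀`), `tendsto_liftG` (`liftG_t κ′ w → Ga w y κ′ l /(m+1)²`), `eventually_castT_eq_iff`.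
* §2 the torus identity read on the lift: `Phat_term_castT` (the gauge term is `(m+1)²·dz (Pf (codiff₁ liftG))`), **`X1aOp_liftG`**
  (`½·curvAdj∘curv + dz∘Rf∘codiff₁ + (a/(m+1)⁸)·𝒬ᵀ𝒬` of `liftG_t` at `(κ, x)` `= (m+1)⁻²·[castT x = castT y ∧ κ = l]`).
* §3 **`vectorLeg_equation`** (X₁a as displayed in `X1-SPEC.md` §0) and **`vectorLeg_equation_weighted`** (the B6/B7 display with `r = 2, a′ = 2a/(m+1)⁸, c = 2`:
  `curvAdj (curv A) κ x = 2·delta1 l y κ x − 2·dz (Rf (codiff₁ A)) κ x − (2a/(m+1)⁸)·𝒬ᵀ𝒬A κ x`).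
Unit `b2b-balaban-beta-d1-p2` (road owner, gen 5).
-/

namespace Summit.QuantumFields.BalabanUV.Beta.D1BFx.VectorLegEquation

open Finset Filter Topology Matrix
open scoped BigOperators ComplexConjugate
open Literature.MathematicalPhysics.QuantumFieldTheory.Balaban1983to89
open Literature.MathematicalPhysics.QuantumFieldTheory.Balaban1983to89.Beta
open B5Prop11Plancherel (Tor fine calG)
open B5Prop11Lattice (gammaZero gammaZero_pos)
open B5Prop11Lower (Lap)
open B5Action121 (GradOp)
open B5Block118 (QvOp)
open B5DeltaA169 (QvAdj DeltaA DeltaA_mul_calG)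
open VectorTails (castT)
open FreeLegDictionary (cubic)
open BlockKernelVolumeSockets (evenPeriod)
open VectorPropagatorLimit (Kinf calG_im_eq_zero abs_calG_re_le calG_re_tendsto_Kinf)
open AffineAveraging (Form0 Form1 unitVec dz curv curvAdj codiff₁ contourSum)
open AffineReproduction (contourSumAdj)
open KKTFluctuationKernel (delta1)
open KKTFluctuationUnique (ofR0 ofR1 dz_ofR0 curv_ofR1 curvAdj_ofR2 codiff₁_ofR1 contourSum_ofR1)
open KernelSpecInstance (curv_smul curvAdj_smul codiff₁_smul dz_smul contourSum_smul contourSumAdj_smul)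
open B6QGQLower276 (X blk)
open Summit.QuantumFields.BalabanUV.Beta.D1BFx.RProjector (Pker Pgt Pgt_apply)
open Summit.QuantumFields.BalabanUV.Beta.D1BFx.KernelFormOperators (kerOp Pf Rf)
open Summit.QuantumFields.BalabanUV.Beta.D1BFx.GluonLeg (Ga)
open Summit.QuantumFields.BalabanUV.Beta.D1BFx.StencilDictionaryTorus (liftT0 liftT1 liftT0_apply liftT1_apply GradOp_mulVec_castT
  GradOp_conjTranspose_mulVec_castT Lap_mulVec_castT QvOpH_QvOp_mulVec_castT_real)
open Summit.QuantumFields.BalabanUV.Beta.D1BFx.PeriodisedKernels (isPeriodic₂_Pker summable_abs_row_Pker valRep siteOf_valRep)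
open Summit.QuantumFields.BalabanUV.Beta.D1BFx.PeriodisedProjector (Phat Phat_apply)
open Summit.QuantumFields.BalabanUV.Beta.D1BFx.FibredPeriodisation (sum_periodise₂_mul_of_rep)
open Summit.QuantumFields.BalabanUV.Beta.D1BFx.GaugeSandwich (PhatC PhatC_eq DeltaA_mulVec_periodisedProjector castT_eq_siteOf castT_valRep
  map_ofReal_mulVec)
open Summit.QuantumFields.BalabanUV.Beta.D1BFx.HodgeIdentityForms (half_curvAdj_curv_add_dz_Rf_codiff₁)
open Summit.QuantumFields.BalabanUV.Beta.D1BFx.VectorLegTannery (X1aOp_eq_of_eventually_eq)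

noncomputable section

variable (m : ℕ) (a : ℝ) (ha : 0 < a)

/-- [folklore] `1 ≤ m + 1` (an5's `hn`). -/
theorem hn_succ : 1 ≤ m + 1 := Nat.succ_le_succ (Nat.zero_le m)

/-! ## §1 The column of `calG_t` at a source bond and its real periodic lift -/

/-- [our object] The column of `calG_t = Δ_a⁻¹` (even cubic volume `t`, an5 level `m+1`) at the source bond `(castT y, l)`. -/
def colG (t : ℕ) (y : X 4) (l : Fin 4) : Tor (fine (m + 1) (cubic 4 (evenPeriod t))) × Fin 4 → ℂ :=
  fun i => calG (m + 1) (hn_succ m) (cubic 4 (evenPeriod t)) a ha i (castT (fine (m + 1) (cubic 4 (evenPeriod t))) y, l)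

/-- [our object] The REAL PERIODIC LIFT of that column to a 1-form on `ℤ⁴`: `liftG t y l κ′ w := Re calG_t((castT w, κ′), (castT y, l))`. -/
def liftG (t : ℕ) (y : X 4) (l : Fin 4) : Form1 4 ℝ :=
  fun κ w => (calG (m + 1) (hn_succ m) (cubic 4 (evenPeriod t)) a ha
    (castT (fine (m + 1) (cubic 4 (evenPeriod t))) w, κ) (castT (fine (m + 1) (cubic 4 (evenPeriod t))) y, l)).re

variable {m a ha}

/-- [folklore] The column is the complexification of its real part (`calG_im_eq_zero`). -/
theorem colG_eq_ofReal (t : ℕ) (y : X 4) (l : Fin 4) :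
    colG m a ha t y l = fun i => (((colG m a ha t y l i).re : ℝ) : ℂ) := by
  funext i
  exact Complex.ext (by simp) (by simp [colG, calG_im_eq_zero])

/-- [folklore] The complex lift of the column is `ofR1` of the real lift. -/
theorem liftT1_colG (t : ℕ) (y : X 4) (l : Fin 4) :
    liftT1 (fine (m + 1) (cubic 4 (evenPeriod t))) (colG m a ha t y l) = ofR1 (liftG m a ha t y l) := by
  funext κ w
  simp only [liftT1_apply, ofR1, liftG, colG]
  exact Complex.ext (by simp) (by simp [calG_im_eq_zero])

/-- [folklore] **THE TORUS IDENTITY, COLUMNWISE**: `DeltaA_t *ᵥ colG = δ_{(castT y, l)}` (`DeltaA_mul_calG`). -/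
theorem DeltaA_mulVec_colG (t : ℕ) (y : X 4) (l : Fin 4) (i : Tor (fine (m + 1) (cubic 4 (evenPeriod t))) × Fin 4) :
    (DeltaA (m + 1) (cubic 4 (evenPeriod t)) a *ᵥ colG m a ha t y l) i
      = if i = (castT (fine (m + 1) (cubic 4 (evenPeriod t))) y, l) then 1 else 0 := by
  have h := congr_fun (congr_fun (DeltaA_mul_calG (m + 1) (hn_succ m) (cubic 4 (evenPeriod t)) a ha) i)
    (castT (fine (m + 1) (cubic 4 (evenPeriod t))) y, l)
  rw [Matrix.mul_apply, Matrix.one_apply] at h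
  simpa only [Matrix.mulVec, dotProduct, colG] using h

/-- [folklore] The volume-free bound `|liftG| ≤ 1/γ₀` (`abs_calG_re_le`). -/
theorem abs_liftG_le (t : ℕ) (y : X 4) (l : Fin 4) (κ : Fin 4) (w : X 4) : |liftG m a ha t y l κ w| ≤ (gammaZero 4 a)⁻¹ :=
  abs_calG_re_le _ _ _ _ _ _ _

/-- [folklore] **THE LIMIT OF THE LIFTS**: `liftG_t y l κ′ w → Ga (m+1) a w y κ′ l / (m+1)²` (`calG_re_tendsto_Kinf`). -/
theorem tendsto_liftG (y : X 4) (l : Fin 4) (κ : Fin 4) (w : X 4) :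
    Tendsto (fun t => liftG m a ha t y l κ w) atTop (𝓝 (((((m + 1 : ℕ) : ℝ) ^ 2)⁻¹) * Ga (m + 1) a w y κ l)) := by
  have h := (calG_re_tendsto_Kinf (m + 1) (hn_succ m) a ha (by norm_num : 3 ≤ 4) w y κ l).const_mul ((((m + 1 : ℕ) : ℝ) ^ 2)⁻¹)
  have hm : (((m + 1 : ℕ) : ℝ) ^ 2) ≠ 0 := by positivity
  refine (h.congr fun t => ?_).trans ?_
  · rw [← mul_assoc, inv_mul_cancel₀ hm, one_mul]; rfl
  · rw [GluonLeg.Ga_apply]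

/-- [folklore] **THE KRONECKER DELTAS**: for `t` large, `castT_t x = castT_t y ↔ x = y`. -/
theorem eventually_castT_eq_iff (x y : X 4) :
    ∀ᶠ t : ℕ in atTop, (castT (fine (m + 1) (cubic 4 (evenPeriod t))) x = castT (fine (m + 1) (cubic 4 (evenPeriod t))) y ↔ x = y) := by
  refine Filter.eventually_atTop.2 ⟨∑ μ, (x μ - y μ).natAbs, fun t ht => ⟨fun h => ?_, fun h => by rw [h]⟩⟩
  funext μ
  have hμ := congr_fun h μ
  simp only [castT] at hμ
  rw [ZMod.intCast_eq_intCast_iff_dvd_sub] at hμ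
  -- `s ∣ (y μ − x μ)` with `s = (m+1)·2(t+1) > |x μ − y μ|` forces equality
  have hs : ((x μ - y μ).natAbs : ℕ) < fine (m + 1) (cubic 4 (evenPeriod t)) μ := by
    have h1 : (x μ - y μ).natAbs ≤ ∑ ν, (x ν - y ν).natAbs :=
      Finset.single_le_sum (f := fun ν => (x ν - y ν).natAbs) (fun ν _ => Nat.zero_le _) (Finset.mem_univ μ)
    have h2 : t < fine (m + 1) (cubic 4 (evenPeriod t)) μ := by
      show t < (m + 1) * (2 * (t + 1))
      nlinarith
    omega
  have h0 : y μ - x μ = 0 := by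
    refine Int.eq_zero_of_dvd_of_natAbs_lt_natAbs hμ ?_
    rw [Int.natAbs_natCast, ← Int.natAbs_neg, neg_sub]
    exact hs
  linarith

/-! ## §2 The torus identity read on the real lift -/

section Readout

variable (t : ℕ) (y : X 4) (l : Fin 4)

/-- [folklore] `∂* col` is REAL on the torus and its value at a reduced point is `(m+1)·δ(liftG)`. -/
theorem GradOpH_colG_castT (w : X 4) :
    ((GradOp (fine (m + 1) (cubic 4 (evenPeriod t))) ((m + 1 : ℕ) : ℂ))ᴴ *ᵥ colG m a ha t y l) (castT (fine (m + 1) (cubic 4 (evenPeriod t))) w)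
      = ((((m + 1 : ℕ) : ℝ) * codiff₁ (liftG m a ha t y l) w : ℝ) : ℂ) := by
  rw [GradOp_conjTranspose_mulVec_castT, liftT1_colG, codiff₁_ofR1, Complex.conj_natCast]
  simp [ofR0]

/-- [folklore] … hence `∂* col` has vanishing imaginary part everywhere and real part `(m+1)·δ(liftG)` at reduced points. -/
theorem GradOpH_colG_im (z : Tor (fine (m + 1) (cubic 4 (evenPeriod t)))) : (((GradOp (fine (m + 1) (cubic 4 (evenPeriod t))) ((m + 1 : ℕ) : ℂ))ᴴ *ᵥ colG m a ha t y l) z).im = 0 := by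
  rw [← castT_valRep m (evenPeriod t) z, GradOpH_colG_castT]
  exact Complex.ofReal_im _

/-- [folklore] **THE GAUGE TERM ON THE LIFT**: `[P̂_ℂ (∂* col)](castT q) = (m+1)·(Pf (m+1) a (codiff₁ liftG)) q` — `P̂` unfolded and regrouped
into the ℤ⁴ projector `P` acting on the periodic lift (`sum_periodise₂_mul_of_rep`). -/
theorem PhatC_GradOpH_colG_castT (q : X 4) :
    (PhatC m a (evenPeriod t) *ᵥ ((GradOp (fine (m + 1) (cubic 4 (evenPeriod t))) ((m + 1 : ℕ) : ℂ))ᴴ *ᵥ colG m a ha t y l)) (castT (fine (m + 1) (cubic 4 (evenPeriod t))) q)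
      = ((((m + 1 : ℕ) : ℝ) * Pf (m + 1) a (codiff₁ (liftG m a ha t y l)) q : ℝ) : ℂ) := by
  set h := (GradOp (fine (m + 1) (cubic 4 (evenPeriod t))) ((m + 1 : ℕ) : ℂ))ᴴ *ᵥ colG m a ha t y l with hh
  have him : (fun j => (h j).im) = 0 := funext fun j => GradOpH_colG_im t y l j
  rw [PhatC_eq, map_ofReal_mulVec, him, Matrix.mulVec_zero]
  simp only [Pi.add_apply, Pi.smul_apply, Pi.zero_apply, Complex.ofReal_zero, smul_zero, add_zero]
  congr 1
  -- the real periodised projector on `re h`, unfolded and regrouped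
  have hre : ∀ w : X 4, (h (castT (fine (m + 1) (cubic 4 (evenPeriod t))) w)).re = ((m + 1 : ℕ) : ℝ) * codiff₁ (liftG m a ha t y l) w := fun w => by
    rw [hh, GradOpH_colG_castT, Complex.ofReal_re]
  have hdiv : m + 1 ∣ (m + 1) * evenPeriod t := ⟨evenPeriod t, rfl⟩
  simp only [Matrix.mulVec, dotProduct, Phat_apply, castT_eq_siteOf]
  rw [sum_periodise₂_mul_of_rep (isPeriodic₂_Pker m ha hdiv) (summable_abs_row_Pker m ha) rfl (fun j => (h j).re)]
  simp only [← castT_eq_siteOf, hre, Pf, KernelFormOperators.kerOp_apply, Pgt_apply, Nat.add_sub_cancel, ← tsum_mul_left]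
  exact tsum_congr fun w => by ring

/-- [folklore] **THE (X₁a) OPERATOR ON THE LIFT = THE TORUS KRONECKER DELTA / (m+1)²**. -/
theorem X1aOp_liftG (κ : Fin 4) (x : X 4) :
    (1 / 2 : ℝ) * curvAdj (curv (liftG m a ha t y l)) κ x + dz (Rf (m + 1) a (codiff₁ (liftG m a ha t y l))) κ x
        + (a / ((m + 1 : ℕ) : ℝ) ^ 8) * contourSumAdj (m + 1) (contourSum (m + 1) (liftG m a ha t y l)) κ x
      = ((((m + 1 : ℕ) : ℝ) ^ 2)⁻¹) * (if castT (fine (m + 1) (cubic 4 (evenPeriod t))) x = castT (fine (m + 1) (cubic 4 (evenPeriod t))) y ∧ κ = l then 1 else 0) := by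
  set G := liftG m a ha t y l with hG
  have hm : (((m + 1 : ℕ) : ℝ)) ≠ 0 := by positivity
  -- the torus identity at `(castT x, κ)` and its expansion through `P̂`
  have h0 := DeltaA_mulVec_colG (m := m) (a := a) (ha := ha) t y l (castT (fine (m + 1) (cubic 4 (evenPeriod t))) x, κ)
  rw [DeltaA_mulVec_periodisedProjector m (evenPeriod t) ha a (colG m a ha t y l)] at h0
  simp only [Pi.add_apply, Pi.sub_apply, Pi.smul_apply, smul_eq_mul] at h0
  -- the three terms on the lift
  have hLap : (Lap (m + 1) (cubic 4 (evenPeriod t)) *ᵥ colG m a ha t y l) (castT (fine (m + 1) (cubic 4 (evenPeriod t))) x, κ)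
      = (((((m + 1 : ℕ) : ℝ)) ^ 2 * codiff₁ (dz (G κ)) x : ℝ) : ℂ) := by
    rw [Lap_mulVec_castT, liftT1_colG, show (ofR1 (liftG m a ha t y l)) κ = ofR0 (G κ) from rfl, dz_ofR0, codiff₁_ofR1]
    simp [ofR0]
  have hGrad : (GradOp (fine (m + 1) (cubic 4 (evenPeriod t))) ((m + 1 : ℕ) : ℂ) *ᵥ (PhatC m a (evenPeriod t) *ᵥ ((GradOp (fine (m + 1) (cubic 4 (evenPeriod t))) ((m + 1 : ℕ) : ℂ))ᴴ *ᵥ colG m a ha t y l)))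
        (castT (fine (m + 1) (cubic 4 (evenPeriod t))) x, κ) = (((((m + 1 : ℕ) : ℝ)) ^ 2 * dz (Pf (m + 1) a (codiff₁ G)) κ x : ℝ) : ℂ) := by
    rw [GradOp_mulVec_castT]
    have hl : liftT0 (fine (m + 1) (cubic 4 (evenPeriod t))) (PhatC m a (evenPeriod t) *ᵥ ((GradOp (fine (m + 1) (cubic 4 (evenPeriod t))) ((m + 1 : ℕ) : ℂ))ᴴ *ᵥ colG m a ha t y l))
        = ofR0 ((((m + 1 : ℕ) : ℝ)) • Pf (m + 1) a (codiff₁ G)) := by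
      funext q; rw [liftT0_apply, PhatC_GradOpH_colG_castT]; rfl
    rw [hl, dz_ofR0, dz_smul]
    simp [ofR1, sq, mul_assoc]
  have hQQ : ((QvOp (m + 1) (cubic 4 (evenPeriod t)))ᴴ *ᵥ (QvOp (m + 1) (cubic 4 (evenPeriod t)) *ᵥ colG m a ha t y l))
        (castT (fine (m + 1) (cubic 4 (evenPeriod t))) x, κ) = ((((1 / ((m + 1 : ℕ) : ℝ) ^ (4 + 1)) ^ 2 * contourSumAdj (m + 1) (contourSum (m + 1) G) κ x : ℝ)) : ℂ) := by
    rw [colG_eq_ofReal]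
    exact QvOpH_QvOp_mulVec_castT_real (m + 1) (cubic 4 (evenPeriod t)) (fun i => (colG m a ha t y l i).re) x κ
  rw [hLap, hGrad, hQQ] at h0
  -- read the identity over `ℝ`
  have hreal : (((m + 1 : ℕ) : ℝ)) ^ 2 * codiff₁ (dz (G κ)) x - (((m + 1 : ℕ) : ℝ)) ^ 2 * dz (Pf (m + 1) a (codiff₁ G)) κ x
      + a * (((m + 1 : ℕ) : ℝ)) ^ 4 * ((1 / ((m + 1 : ℕ) : ℝ) ^ (4 + 1)) ^ 2 * contourSumAdj (m + 1) (contourSum (m + 1) G) κ x)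
      = if castT (fine (m + 1) (cubic 4 (evenPeriod t))) x = castT (fine (m + 1) (cubic 4 (evenPeriod t))) y ∧ κ = l then 1 else 0 := by
    have h1 := congrArg Complex.re h0
    have e4 : ((((m + 1 : ℕ) : ℂ)) ^ 4).re = (((m + 1 : ℕ) : ℝ)) ^ 4 := by
      rw [← Complex.ofReal_natCast, ← Complex.ofReal_pow, Complex.ofReal_re]
    simp only [Complex.sub_re, Complex.add_re, Complex.mul_re, Complex.ofReal_re, Complex.ofReal_im, mul_zero, sub_zero, e4,
      zero_mul, apply_ite Complex.re, Complex.one_re, Complex.zero_re, Prod.mk.injEq] at h1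
    exact h1
  rw [half_curvAdj_curv_add_dz_Rf_codiff₁]
  have e : a / ((m + 1 : ℕ) : ℝ) ^ 8 = ((((m + 1 : ℕ) : ℝ) ^ 2)⁻¹) * (a * (((m + 1 : ℕ) : ℝ)) ^ 4 * (1 / ((m + 1 : ℕ) : ℝ) ^ (4 + 1)) ^ 2) := by
    field_simp; ring
  rw [e, ← hreal]
  field_simp

end Readout

/-! ## §3 X₁a -/

section Main

/-- [folklore] The (X₁a) operator is homogeneous: scaling the 1-form by `c` scales its value by `c`. -/
theorem X1aOp_smul (n : ℕ) (a a' c : ℝ) (A : Form1 4 ℝ) (κ : Fin 4) (x : X 4) :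
    (1 / 2 : ℝ) * curvAdj (curv (c • A)) κ x + dz (Rf n a (codiff₁ (c • A))) κ x + a' * contourSumAdj n (contourSum n (c • A)) κ x
      = c * ((1 / 2 : ℝ) * curvAdj (curv A) κ x + dz (Rf n a (codiff₁ A)) κ x + a' * contourSumAdj n (contourSum n A) κ x) := by
  have hRf : Rf n a (codiff₁ (c • A)) = c • Rf n a (codiff₁ A) := by
    funext p
    simp only [Rf, Pf, codiff₁_smul, Pi.sub_apply, Pi.smul_apply, smul_eq_mul, KernelFormOperators.kerOp_smul]
    ring
  rw [curv_smul, curvAdj_smul, hRf, dz_smul, contourSum_smul, contourSumAdj_smul]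
  simp only [Pi.smul_apply, smul_eq_mul]
  ring

variable (m) (a) (ha)
include ha

/-- [folklore] **X₁a, SCALED**: the (X₁a) operator applied to `(m+1)⁻²·Ga(·, y)(·, l)` equals `(m+1)⁻²·δ_{(l,y)}` — `X1aOp_eq_of_eventually_eq` along the
even cubic volumes with `F_t := liftG_t`, the bound `1/γ₀`, the limit `calG_re_tendsto_Kinf`, the torus identities `X1aOp_liftG`, and the eventual
Kronecker deltas. -/
theorem vectorLeg_equation_scaled (l : Fin 4) (y : X 4) (κ : Fin 4) (x : X 4) :
    (1 / 2 : ℝ) * curvAdj (curv (fun κ' w => ((((m + 1 : ℕ) : ℝ) ^ 2)⁻¹) * Ga (m + 1) a w y κ' l)) κ x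
        + dz (Rf (m + 1) a (codiff₁ (fun κ' w => ((((m + 1 : ℕ) : ℝ) ^ 2)⁻¹) * Ga (m + 1) a w y κ' l))) κ x
        + (a / ((m + 1 : ℕ) : ℝ) ^ 8) * contourSumAdj (m + 1) (contourSum (m + 1) (fun κ' w => ((((m + 1 : ℕ) : ℝ) ^ 2)⁻¹) * Ga (m + 1) a w y κ' l)) κ x
      = ((((m + 1 : ℕ) : ℝ) ^ 2)⁻¹) * (if x = y ∧ κ = l then 1 else 0) := by
  refine X1aOp_eq_of_eventually_eq (m + 1) ha (a / ((m + 1 : ℕ) : ℝ) ^ 8) (𝓕 := atTop) (F := fun t => liftG m a ha t y l)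
    (B := (gammaZero 4 a)⁻¹) (Filter.Eventually.of_forall fun t κ' w => abs_liftG_le t y l κ' w) (fun κ' w => tendsto_liftG y l κ' w)
    (e := fun t => ((((m + 1 : ℕ) : ℝ) ^ 2)⁻¹) *
      (if castT (fine (m + 1) (cubic 4 (evenPeriod t))) x = castT (fine (m + 1) (cubic 4 (evenPeriod t))) y ∧ κ = l then 1 else 0))
    (Filter.Eventually.of_forall fun t => X1aOp_liftG t y l κ x) ?_
  refine tendsto_const_nhds.congr' ((eventually_castT_eq_iff (m := m) x y).mono fun t ht => ?_)
  simp only [ht]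

/-- [our object → theorem] **X₁a — THE R-WEIGHTED VECTOR EQUATION OF THE REDUCED BF GLUON LEG ON ℤ⁴** (`X1-SPEC.md` §0; the one analytic input of
slot (K)'s kernel dictionary): for every source bond `(l, y)` and every bond `(κ, x)`, with `A κ′ w := Ga (m+1) a w y κ′ l`,
`½·curvAdj (curv A) κ x + dz (Rf (m+1) a (codiff₁ A)) κ x + (a/(m+1)⁸)·contourSumAdj (m+1) (contourSum (m+1) A) κ x = δ_{x,y} δ_{κ,l}`. -/
theorem vectorLeg_equation (l : Fin 4) (y : X 4) (κ : Fin 4) (x : X 4) :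
    (1 / 2 : ℝ) * curvAdj (curv (fun κ' w => Ga (m + 1) a w y κ' l)) κ x + dz (Rf (m + 1) a (codiff₁ (fun κ' w => Ga (m + 1) a w y κ' l))) κ x
        + (a / ((m + 1 : ℕ) : ℝ) ^ 8) * contourSumAdj (m + 1) (contourSum (m + 1) (fun κ' w => Ga (m + 1) a w y κ' l)) κ x
      = if x = y ∧ κ = l then 1 else 0 := by
  have hm : ((((m + 1 : ℕ) : ℝ) ^ 2)⁻¹) ≠ 0 := by positivity
  have h := vectorLeg_equation_scaled m a ha l y κ x
  have e : (fun κ' w => ((((m + 1 : ℕ) : ℝ) ^ 2)⁻¹) * Ga (m + 1) a w y κ' l)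
      = ((((m + 1 : ℕ) : ℝ) ^ 2)⁻¹) • (fun κ' w => Ga (m + 1) a w y κ' l) := by
    funext κ' w; simp only [Pi.smul_apply, smul_eq_mul]
  rw [e, X1aOp_smul] at h
  exact mul_left_cancel₀ hm h

/-- [folklore] **X₁a IN THE DISPLAYED SHAPE OF B6/B6′/B7** (`LandauDictionaryHWeighted.hX1a`, `LandauResolventSuperposition`, `LandauDictionaryGamma`) with
the constants of record `r = 2`, `a′ = 2a/(m+1)⁸`, `c = 2`:
`curvAdj (curv A) κ x = 2·delta1 l y κ x − 2·dz (Rf (codiff₁ A)) κ x − (2a/(m+1)⁸)·𝒬ᵀ𝒬A κ x`. -/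
theorem vectorLeg_equation_weighted (l : Fin 4) (y : X 4) (κ : Fin 4) (x : X 4) :
    curvAdj (curv (fun κ' w => Ga (m + 1) a w y κ' l)) κ x
      = 2 * delta1 l y κ x - 2 * dz (Rf (m + 1) a (codiff₁ (fun κ' w => Ga (m + 1) a w y κ' l))) κ x
        - (2 * a / ((m + 1 : ℕ) : ℝ) ^ 8) * contourSumAdj (m + 1) (contourSum (m + 1) (fun κ' w => Ga (m + 1) a w y κ' l)) κ x := by
  have h := vectorLeg_equation m a ha l y κ x
  have hδ : delta1 l y κ x = if x = y ∧ κ = l then 1 else 0 := by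
    simp only [delta1, and_comm]
  rw [hδ, ← h]
  ring

end Main

end

end Summit.QuantumFields.BalabanUV.Beta.D1BFx.VectorLegEquation
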